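import Literature.Analysis.FluidPDE.OseenHeatSemigroup
import Literature.Analysis.UnboundedOperators.HeatKernelBoundedData
import Literature.Analysis.FluidPDE.HelmholtzAnnihilator
import HarnessLib

/-!
# Derivatives fall on the data for the Oseen–heat operator: `∂ᵥ (𝒩_τ G)ᵢ = (𝒩_τ (∂ᵥ G))ᵢ`

Analysis/FluidPDE support file (regularity layer of the physical-space `L^∞` theory of mild
Navier–Stokes solutions, towards `Literature.Analysis.FluidPDE.leray_strong_local_existence`). For a
matrix field `G` with `C¹`, bounded components with bounded gradients, the spatial derivative of the
heat-flow realisation `oseenHeat τ G = e^{τΔ} P∇·G` (`OseenHeat.lean`) is the same operator applied to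
the differentiated data (`fderiv_oseenHeat_apply_eq`) — the translation invariance of `e^{τΔ} P∇·`
used to put derivatives on the nonlinearity in Leray's and Ożański–Pooley's regularity bootstrap
(Leray 1934, §§11–12, 15; Ożański–Pooley 2018, Lemma 6.7 (ii), Lemma 6.9 (ii): "derivatives fall on
the data"; Lemarié-Rieusset 2016, §6.2). Layers:

* `fderiv_fderiv_apply_symm_of_contDiff_two` (Schwarz), `fderiv_heatD1_apply_eq`: `∂ᵥ (∂_w e^{sΔ} φ) = ∂_w e^{sΔ} (∂ᵥφ)`
  for `φ ∈ C¹ ∩ L^∞` with `∂ᵥφ ∈ L^∞` (symmetry of `D² e^{sΔ}φ`, the tree's `fderiv_fderiv_apply_comm` of `HelmholtzAnnihilator`, plus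
  the tree's `fderiv_heatExtension_apply_eq_heatExtension_fderiv`);
* `heatD1_regular` (smoothness, boundedness and a gradient bound of `∂_w e^{sΔ} ψ` for bounded `ψ`),
  `fderiv_heatD3_apply_eq` (three `D¹` layers);
* `hasFDerivAt_integral_Ioi_heatD3`, `fderiv_integral_Ioi_heatD3_apply_eq`: dominated differentiation
  of the Leray correction `∫₀^∞ ∂³ e^{(c+σ)Δ} φ dσ` under the integral sign (the `x`-derivative of the
  integrand is `∂³ e^{(c+σ)Δ}(∂ᵥφ) = O((c+σ)^{-3/2})`);
* `fderiv_oseenHeat_apply_eq`: the assembled statement.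

Everything is proved; no named facts.

## Mathlib / tree search

Tree: `OseenHeat`, `OseenHeatSemigroup` (`heatExtension_heatD1/heatD3`, `continuousOn_heatD3_const_add`,
`norm_heatD3_le_of_top`, `integrableOn_heatD3_const_add_of_top`, `integrableOn_const_mul_rpow_const_add`),
`HeatFlowCalculus` (`fderiv_heatExtension_apply_eq_heatExtension_fderiv`), `HeatKernelBoundedData`
(`norm_fderiv_heatExtension_le_of_bounded`). Mathlib: `ContDiffAt.isSymmSndFDerivAt`,
`hasFDerivAt_integral_of_dominated_of_fderiv_le`, `continuousOn_clm_apply`,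
`ContinuousLinearMap.integral_apply`, `HasFDerivAt.sum`.

## References

* J. Leray, Acta Math. 63 (1934), §§11–12, §15. [Leray1934]
* W. S. Ożański, B. C. Pooley, LMS Lecture Note Ser. 452 (CUP 2018), Lemma 6.7, Lemma 6.9.
  [OzanskiPooley2018]
* P. G. Lemarié-Rieusset, *The Navier–Stokes Problem in the 21st Century*, CRC 2016, §6.2.
  [LemarieRieusset2016]
-/

open MeasureTheory Filter Topology Set InnerProductSpace Metric
open scoped Real ENNReal NNReal Convolution Laplacian RealInnerProductSpace

noncomputable section

namespace Literature.Analysis.FluidPDE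

section Commute

variable {E : Type*} [NormedAddCommGroup E] [InnerProductSpace ℝ E] [FiniteDimensional ℝ E]
  [MeasurableSpace E] [BorelSpace E]

/-- **Derivatives fall on `C¹` data, `D¹` level**: for `φ ∈ C¹` bounded with bounded `∂ᵥφ`,
`∂ᵥ (∂_w e^{sΔ} φ) = ∂_w e^{sΔ} (∂ᵥ φ)`, i.e. `∂ᵥ (heatD1 s w φ) = heatD1 s w (∂ᵥφ)`. [folklore] -/
theorem fderiv_heatD1_apply_eq {φ : E → ℝ} (hφ : ContDiff ℝ 1 φ) (hφm : MemLp φ ∞ volume) {v : E}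
    (hφv : MemLp (fun y => fderiv ℝ φ y v) ∞ volume) {s : ℝ} (hs : 0 < s) (w x : E) :
    fderiv ℝ (heatD1 s w φ) x v = heatD1 s w (fun y => fderiv ℝ φ y v) x := by
  have hH : ContDiff ℝ 2 (UnboundedOperators.heatExtension φ s) :=
    contDiff_infty.1 (UnboundedOperators.contDiff_heatExtension_holds hφm le_top hs) 2
  unfold heatD1
  rw [fderiv_fderiv_apply_comm hH x v w]
  have hfun : (fun y => fderiv ℝ (UnboundedOperators.heatExtension φ s) y v) =
      UnboundedOperators.heatExtension (fun y => fderiv ℝ φ y v) s :=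
    funext fun y => UnboundedOperators.fderiv_heatExtension_apply_eq_heatExtension_fderiv hφ hφm le_top hφv le_top hs y
  rw [hfun]

end Commute

section Commute2

variable {E : Type*} [NormedAddCommGroup E] [InnerProductSpace ℝ E] [FiniteDimensional ℝ E]
  [MeasurableSpace E] [BorelSpace E]

variable {φ : E → ℝ}

/-- A `C¹` function with operator-norm bounded derivative has bounded directional derivatives in
`L^∞`. [folklore] -/
theorem memLp_top_fderiv_apply (hφ : ContDiff ℝ 1 φ) {K : ℝ} (hK : ∀ y, ‖fderiv ℝ φ y‖ ≤ K) (v : E) :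
    MemLp (fun y => fderiv ℝ φ y v) ∞ volume ∧ ∀ y, ‖fderiv ℝ φ y v‖ ≤ K * ‖v‖ := by
  have hc : Continuous fun y => fderiv ℝ φ y v := (hφ.continuous_fderiv one_ne_zero).clm_apply continuous_const
  have hb : ∀ y, ‖fderiv ℝ φ y v‖ ≤ K * ‖v‖ := fun y =>
    (ContinuousLinearMap.le_opNorm _ _).trans (mul_le_mul_of_nonneg_right (hK y) (norm_nonneg _))
  exact ⟨memLp_top_of_bound hc.aestronglyMeasurable _ (Eventually.of_forall hb), hb⟩

/-- `heatD1 s w ψ` of bounded `ψ` is smooth, bounded, with operator-norm bounded derivative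
(`= e^{(s/2)Δ}` of the bounded continuous `heatD1 (s/2) w ψ`, then the sup-norm gradient estimate).
[folklore] -/
theorem heatD1_regular {ψ : E → ℝ} (hψ : MemLp ψ ∞ volume) {s : ℝ} (hs : 0 < s) (w : E) :
    ContDiff ℝ 1 (heatD1 s w ψ) ∧ MemLp (heatD1 s w ψ) ∞ volume ∧
      ∃ K, ∀ y, ‖fderiv ℝ (heatD1 s w ψ) y‖ ≤ K := by
  have hmem : MemLp (heatD1 s w ψ) ∞ volume := memLp_heatD1 hψ le_top hs w
  refine ⟨contDiff_heatD1 hψ le_top hs w, hmem, ?_⟩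
  have h2 : 0 < s / 2 := half_pos hs
  set g := heatD1 (s / 2) w ψ with hg
  have hgm : MemLp g ∞ volume := memLp_heatD1 hψ le_top h2 w
  have hgc : Continuous g := (contDiff_heatD1 hψ le_top h2 w (n := 0)).continuous
  set C : ℝ := (2 : ℝ) ^ ((Module.finrank ℝ E : ℝ) / 2) * (s / 2) ^ (-(1 / 2) : ℝ) * ‖w‖ * (eLpNorm ψ ∞ volume).toReal
  have hgb : ∀ z, ‖g z‖ ≤ C := fun z => norm_heatD1_le_of_top hψ h2 w z
  have hrepr : heatD1 s w ψ = UnboundedOperators.heatExtension g (s / 2) := by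
    rw [hg, heatExtension_heatD1 hψ le_top h2 h2 w, add_halves]
  refine ⟨(2 : ℝ) ^ ((Module.finrank ℝ E : ℝ) / 2) * (s / 2) ^ (-(1 / 2 : ℝ)) * C, fun y => ?_⟩
  rw [hrepr]
  exact UnboundedOperators.norm_fderiv_heatExtension_le_of_bounded hgc.aestronglyMeasurable hgb h2 y

/-- **Derivatives fall on `C¹` data, `D³` level** (three `D¹` layers at the clock `s/3`). [folklore] -/
theorem fderiv_heatD3_apply_eq (hφ : ContDiff ℝ 1 φ) (hφm : MemLp φ ∞ volume) {v : E}
    (hφv : MemLp (fun y => fderiv ℝ φ y v) ∞ volume) {s : ℝ} (hs : 0 < s) (u w z x : E) :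
    fderiv ℝ (heatD3 s u w z φ) x v = heatD3 s u w z (fun y => fderiv ℝ φ y v) x := by
  have h3 : 0 < s / 3 := by positivity
  have hsplit : s = s / 3 + s / 3 + s / 3 := by ring
  -- layer 1
  set ψ₁ := heatD1 (s / 3) z φ with hψ₁
  obtain ⟨hψ₁c, hψ₁m, K₁, hK₁⟩ := heatD1_regular hφm h3 z
  have hψ₁v : MemLp (fun y => fderiv ℝ ψ₁ y v) ∞ volume := (memLp_top_fderiv_apply hψ₁c hK₁ v).1
  have hd₁ : (fun y => fderiv ℝ ψ₁ y v) = heatD1 (s / 3) z (fun y => fderiv ℝ φ y v) :=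
    funext fun y => fderiv_heatD1_apply_eq hφ hφm hφv h3 z y
  -- layer 2
  set ψ₂ := heatD1 (s / 3) w ψ₁ with hψ₂
  obtain ⟨hψ₂c, hψ₂m, K₂, hK₂⟩ := heatD1_regular hψ₁m h3 w
  have hψ₂v : MemLp (fun y => fderiv ℝ ψ₂ y v) ∞ volume := (memLp_top_fderiv_apply hψ₂c hK₂ v).1
  have hd₂ : (fun y => fderiv ℝ ψ₂ y v) = heatD1 (s / 3) w (fun y => fderiv ℝ ψ₁ y v) :=
    funext fun y => fderiv_heatD1_apply_eq hψ₁c hψ₁m hψ₁v h3 w y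
  -- layer 3
  have hd₃ : fderiv ℝ (heatD1 (s / 3) u ψ₂) x v = heatD1 (s / 3) u (fun y => fderiv ℝ ψ₂ y v) x :=
    fderiv_heatD1_apply_eq hψ₂c hψ₂m hψ₂v h3 u x
  have hmemv : MemLp (fun y => fderiv ℝ φ y v) ∞ volume := hφv
  conv_lhs => rw [hsplit, heatD3_eq_heatD1_heatD1_heatD1 hφm le_top h3 h3 h3 u w z]
  rw [show heatD1 (s / 3) w (heatD1 (s / 3) z φ) = ψ₂ by rw [hψ₂, hψ₁]]
  rw [hd₃, hd₂, hd₁]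
  conv_rhs => rw [hsplit, heatD3_eq_heatD1_heatD1_heatD1 hmemv le_top h3 h3 h3 u w z]

variable (hE : Module.finrank ℝ E = 3)
include hE

/-- **Derivatives fall on `C¹` data, Leray-correction level**: for `φ ∈ C¹` bounded with bounded
gradient, `x ↦ ∫₀^∞ ∂³ e^{(c+σ)Δ} φ (x) dσ` is differentiable with
`∂ᵥ ∫₀^∞ ∂³ e^{(c+σ)Δ} φ dσ = ∫₀^∞ ∂³ e^{(c+σ)Δ} (∂ᵥφ) dσ` (dominated differentiation under the
integral sign, the `x`-derivative of the integrand being `∂³ e^{(c+σ)Δ}(∂ᵥφ) = O((c+σ)^{-3/2})`).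
[folklore] -/
theorem hasFDerivAt_integral_Ioi_heatD3 (hφ : ContDiff ℝ 1 φ) (hφm : MemLp φ ∞ volume) {K : ℝ}
    (hK : ∀ y, ‖fderiv ℝ φ y‖ ≤ K) {c : ℝ} (hc : 0 < c) (i j k : Fin (Module.finrank ℝ E)) (x₀ : E) :
    HasFDerivAt (fun x => ∫ σ in Ioi (0:ℝ), heatD3 (c + σ) (stdOrthonormalBasis ℝ E i)
        (stdOrthonormalBasis ℝ E j) (stdOrthonormalBasis ℝ E k) φ x)
      (∫ σ in Ioi (0:ℝ), fderiv ℝ (heatD3 (c + σ) (stdOrthonormalBasis ℝ E i)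
        (stdOrthonormalBasis ℝ E j) (stdOrthonormalBasis ℝ E k) φ) x₀) x₀ := by
  set b := stdOrthonormalBasis ℝ E
  have hK0 : 0 ≤ K := (norm_nonneg _).trans (hK x₀)
  -- the directional derivatives of the data
  have hdv : ∀ v, MemLp (fun y => fderiv ℝ φ y v) ∞ volume ∧ ∀ y, ‖fderiv ℝ φ y v‖ ≤ K * ‖v‖ := fun v =>
    memLp_top_fderiv_apply hφ hK v
  have hev : ∀ v, eLpNorm (fun y => fderiv ℝ φ y v) ∞ volume ≤ ENNReal.ofReal (K * ‖v‖) := fun v => by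
    rw [eLpNorm_exponent_top]
    exact eLpNormEssSup_le_of_ae_bound (Eventually.of_forall (hdv v).2)
  -- the integrand, its derivative and the bound
  set F : E → ℝ → ℝ := fun x σ => heatD3 (c + σ) (b i) (b j) (b k) φ x with hF
  set F' : E → ℝ → (E →L[ℝ] ℝ) := fun x σ => fderiv ℝ (heatD3 (c + σ) (b i) (b j) (b k) φ) x with hF'
  have hF'v : ∀ x σ, 0 < σ → ∀ v, F' x σ v = heatD3 (c + σ) (b i) (b j) (b k) (fun y => fderiv ℝ φ y v) x := by
    intro x σ hσ v
    exact fderiv_heatD3_apply_eq hφ hφm (hdv v).1 (by linarith) (b i) (b j) (b k) x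
  have hbound : ∀ σ, 0 < σ → ∀ x, ‖F' x σ‖ ≤ 162 * K * (c + σ) ^ (-(3 / 2 : ℝ)) := by
    intro σ hσ x
    refine ContinuousLinearMap.opNorm_le_bound _ (by positivity) fun v => ?_
    rw [hF'v x σ hσ v]
    have h1 := norm_heatD3_le_of_top hE (hdv v).1 (by linarith : 0 < c + σ) i j k x
    have h2 : (eLpNorm (fun y => fderiv ℝ φ y v) ∞ volume).toReal ≤ K * ‖v‖ := by
      have := ENNReal.toReal_mono ENNReal.ofReal_ne_top (hev v)
      rwa [ENNReal.toReal_ofReal (by positivity)] at this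
    have h3 : 0 ≤ 162 * (c + σ) ^ (-(3 / 2 : ℝ)) := by positivity
    calc _ ≤ 162 * (c + σ) ^ (-(3 / 2 : ℝ)) * (eLpNorm (fun y => fderiv ℝ φ y v) ∞ volume).toReal := h1
      _ ≤ 162 * (c + σ) ^ (-(3 / 2 : ℝ)) * (K * ‖v‖) := mul_le_mul_of_nonneg_left h2 h3
      _ = 162 * K * (c + σ) ^ (-(3 / 2 : ℝ)) * ‖v‖ := by ring
  -- smoothness of the integrand in `x`
  have hsmooth : ∀ σ, 0 < σ → ContDiff ℝ 1 (heatD3 (c + σ) (b i) (b j) (b k) φ) := fun σ hσ => by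
    have h2 : 0 < (c + σ) / 2 := by have : (0:ℝ) < σ := hσ; linarith
    rw [show c + σ = (c + σ) / 2 + (c + σ) / 2 by ring, ← heatExtension_heatD3 hφm le_top h2 h2]
    exact contDiff_infty.1 (UnboundedOperators.contDiff_heatExtension_holds
      (memLp_heatD3 hφm le_top h2 _ _ _) le_top h2) 1
  refine hasFDerivAt_integral_of_dominated_of_fderiv_le (μ := volume.restrict (Ioi (0:ℝ))) (s := univ)
    (F := F) (F' := F') (bound := fun σ => 162 * K * (c + σ) ^ (-(3 / 2 : ℝ))) univ_mem ?_ ?_ ?_ ?_ ?_ ?_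
  · exact Eventually.of_forall fun x =>
      (continuousOn_heatD3_const_add hφm le_top hc (b i) (b j) (b k) x).aestronglyMeasurable measurableSet_Ioi
  · exact integrableOn_heatD3_const_add_of_top hE hφm hc i j k x₀
  · -- measurability of the CLM-valued derivative in `σ`: all its evaluations are continuous
    have hc' : ContinuousOn (fun σ => F' x₀ σ) (Ioi 0) := by
      rw [continuousOn_clm_apply]
      intro v
      refine (continuousOn_heatD3_const_add (hdv v).1 le_top hc (b i) (b j) (b k) x₀).congr fun σ hσ => ?_
      exact hF'v x₀ σ hσ v
    exact hc'.aestronglyMeasurable measurableSet_Ioi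
  · exact (ae_restrict_iff' measurableSet_Ioi).2 (Eventually.of_forall fun σ hσ x _ => hbound σ hσ x)
  · exact integrableOn_const_mul_rpow_const_add hc (by norm_num) _
  · refine (ae_restrict_iff' measurableSet_Ioi).2 (Eventually.of_forall fun σ hσ x _ => ?_)
    exact (((hsmooth σ hσ).differentiable one_ne_zero) x).hasFDerivAt

/-- Corollary: `∂ᵥ ∫₀^∞ ∂³ e^{(c+σ)Δ} φ dσ = ∫₀^∞ ∂³ e^{(c+σ)Δ} (∂ᵥφ) dσ`. [folklore] -/
theorem fderiv_integral_Ioi_heatD3_apply_eq (hφ : ContDiff ℝ 1 φ) (hφm : MemLp φ ∞ volume) {K : ℝ}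
    (hK : ∀ y, ‖fderiv ℝ φ y‖ ≤ K) {c : ℝ} (hc : 0 < c) (i j k : Fin (Module.finrank ℝ E)) (x v : E) :
    fderiv ℝ (fun x => ∫ σ in Ioi (0:ℝ), heatD3 (c + σ) (stdOrthonormalBasis ℝ E i)
        (stdOrthonormalBasis ℝ E j) (stdOrthonormalBasis ℝ E k) φ x) x v =
      ∫ σ in Ioi (0:ℝ), heatD3 (c + σ) (stdOrthonormalBasis ℝ E i)
        (stdOrthonormalBasis ℝ E j) (stdOrthonormalBasis ℝ E k) (fun y => fderiv ℝ φ y v) x := by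
  have h := hasFDerivAt_integral_Ioi_heatD3 hE hφ hφm hK hc i j k x
  rw [h.fderiv]
  have hint : Integrable (fun σ => fderiv ℝ (heatD3 (c + σ) (stdOrthonormalBasis ℝ E i)
      (stdOrthonormalBasis ℝ E j) (stdOrthonormalBasis ℝ E k) φ) x) (volume.restrict (Ioi (0:ℝ))) := by
    -- the derivative of the parametric integral exists in particular as an integrable CLM family
    have hK0 : 0 ≤ K := (norm_nonneg _).trans (hK x)
    have hdv : ∀ w, MemLp (fun y => fderiv ℝ φ y w) ∞ volume ∧ ∀ y, ‖fderiv ℝ φ y w‖ ≤ K * ‖w‖ := fun w =>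
      memLp_top_fderiv_apply hφ hK w
    have hmeas : AEStronglyMeasurable (fun σ => fderiv ℝ (heatD3 (c + σ) (stdOrthonormalBasis ℝ E i)
        (stdOrthonormalBasis ℝ E j) (stdOrthonormalBasis ℝ E k) φ) x) (volume.restrict (Ioi (0:ℝ))) := by
      have hc' : ContinuousOn (fun σ => fderiv ℝ (heatD3 (c + σ) (stdOrthonormalBasis ℝ E i)
          (stdOrthonormalBasis ℝ E j) (stdOrthonormalBasis ℝ E k) φ) x) (Ioi 0) := by
        rw [continuousOn_clm_apply]
        intro w
        refine (continuousOn_heatD3_const_add (hdv w).1 le_top hc (stdOrthonormalBasis ℝ E i)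
          (stdOrthonormalBasis ℝ E j) (stdOrthonormalBasis ℝ E k) x).congr fun σ hσ => ?_
        have hσ' : (0:ℝ) < σ := hσ
        exact fderiv_heatD3_apply_eq hφ hφm (hdv w).1 (by linarith) _ _ _ x
      exact hc'.aestronglyMeasurable measurableSet_Ioi
    refine Integrable.mono' (integrableOn_const_mul_rpow_const_add hc (by norm_num : (1:ℝ) < 3 / 2) (162 * K)) hmeas ?_
    refine (ae_restrict_iff' measurableSet_Ioi).2 (Eventually.of_forall fun σ hσ => ?_)
    have hσ' : (0:ℝ) < σ := hσ
    refine ContinuousLinearMap.opNorm_le_bound _ (by positivity) fun w => ?_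
    rw [fderiv_heatD3_apply_eq hφ hφm (hdv w).1 (by linarith) _ _ _ x]
    have h1 := norm_heatD3_le_of_top hE (hdv w).1 (by linarith : 0 < c + σ) i j k x
    have h2 : (eLpNorm (fun y => fderiv ℝ φ y w) ∞ volume).toReal ≤ K * ‖w‖ := by
      have hev : eLpNorm (fun y => fderiv ℝ φ y w) ∞ volume ≤ ENNReal.ofReal (K * ‖w‖) := by
        rw [eLpNorm_exponent_top]; exact eLpNormEssSup_le_of_ae_bound (Eventually.of_forall (hdv w).2)
      have := ENNReal.toReal_mono ENNReal.ofReal_ne_top hev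
      rwa [ENNReal.toReal_ofReal (by positivity)] at this
    have h3 : 0 ≤ 162 * (c + σ) ^ (-(3 / 2 : ℝ)) := by positivity
    calc _ ≤ 162 * (c + σ) ^ (-(3 / 2 : ℝ)) * (eLpNorm (fun y => fderiv ℝ φ y w) ∞ volume).toReal := h1
      _ ≤ 162 * (c + σ) ^ (-(3 / 2 : ℝ)) * (K * ‖w‖) := mul_le_mul_of_nonneg_left h2 h3
      _ = 162 * K * (c + σ) ^ (-(3 / 2 : ℝ)) * ‖w‖ := by ring
  rw [ContinuousLinearMap.integral_apply hint v]
  refine setIntegral_congr_fun measurableSet_Ioi fun σ hσ => ?_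
  have hσ' : (0 : ℝ) < σ := hσ
  exact fderiv_heatD3_apply_eq hφ hφm (memLp_top_fderiv_apply hφ hK v).1 (by linarith) _ _ _ x

/-- **Derivatives fall on `C¹` data for the Oseen–heat operator**: for a matrix field `G` with `C¹`,
bounded components with bounded gradients, `∂ᵥ (𝒩_τ G)ᵢ = (𝒩_τ (∂ᵥ G))ᵢ` — translation invariance of
`e^{τΔ} P∇·` (Lemarié-Rieusset 2016, §6.2; Ożański–Pooley 2018, Lemma 6.7 (ii): "derivatives fall on
the data"). [folklore] -/
theorem fderiv_oseenHeat_apply_eq {G : Fin (Module.finrank ℝ E) → Fin (Module.finrank ℝ E) → E → ℝ}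
    (hG1 : ∀ j k, ContDiff ℝ 1 (G j k)) (hGm : ∀ j k, MemLp (G j k) ∞ volume)
    (hGd : ∀ j k, ∃ K, ∀ y, ‖fderiv ℝ (G j k) y‖ ≤ K) {τ : ℝ} (hτ : 0 < τ)
    (i : Fin (Module.finrank ℝ E)) (x v : E) :
    fderiv ℝ (oseenHeat τ G i) x v = oseenHeat τ (fun j k y => fderiv ℝ (G j k) y v) i x := by
  set b := stdOrthonormalBasis ℝ E
  -- the two groups of summands as `HasFDerivAt` statements
  have hA : ∀ j, HasFDerivAt (heatD1 τ (b j) (G j i)) (fderiv ℝ (heatD1 τ (b j) (G j i)) x) x := fun j =>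
    (((contDiff_heatD1 (hGm j i) le_top hτ (b j) (n := 1)).differentiable one_ne_zero) x).hasFDerivAt
  have hB : ∀ j k, HasFDerivAt (fun y => ∫ σ in Ioi (0:ℝ), heatD3 (τ + σ) (b i) (b j) (b k) (G j k) y)
      (∫ σ in Ioi (0:ℝ), fderiv ℝ (heatD3 (τ + σ) (b i) (b j) (b k) (G j k)) x) x := fun j k => by
    obtain ⟨K, hK⟩ := hGd j k
    exact hasFDerivAt_integral_Ioi_heatD3 hE (hG1 j k) (hGm j k) hK hτ i j k x
  have hsum : HasFDerivAt (oseenHeat τ G i)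
      ((∑ j, fderiv ℝ (heatD1 τ (b j) (G j i)) x) +
        ∑ j, ∑ k, ∫ σ in Ioi (0:ℝ), fderiv ℝ (heatD3 (τ + σ) (b i) (b j) (b k) (G j k)) x) x := by
    have h1 := HasFDerivAt.sum (u := Finset.univ) fun j (_ : j ∈ Finset.univ) => hA j
    have h2 := HasFDerivAt.sum (u := Finset.univ) fun j (_ : j ∈ Finset.univ) =>
      HasFDerivAt.sum (u := Finset.univ) fun k (_ : k ∈ Finset.univ) => hB j k
    have h12 := h1.add h2
    refine h12.congr_of_eventuallyEq (Eventually.of_forall fun y => ?_)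
    simp only [oseenHeat, Pi.add_apply, Finset.sum_apply]
    rfl
  rw [hsum.fderiv]
  simp only [_root_.add_apply, FunLike.coe_sum, Finset.sum_apply, oseenHeat]
  congr 1
  · refine Finset.sum_congr rfl fun j _ => ?_
    obtain ⟨K, hK⟩ := hGd j i
    exact fderiv_heatD1_apply_eq (hG1 j i) (hGm j i) (memLp_top_fderiv_apply (hG1 j i) hK v).1 hτ (b j) x
  · refine Finset.sum_congr rfl fun j _ => Finset.sum_congr rfl fun k _ => ?_
    obtain ⟨K, hK⟩ := hGd j k
    rw [← (hB j k).fderiv]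
    exact fderiv_integral_Ioi_heatD3_apply_eq hE (hG1 j k) (hGm j k) hK hτ i j k x v

end Commute2

end Literature.Analysis.FluidPDE
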